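import Summits.Ventures.PercRepro.S1DisjointSumCircuitFive

/-!
# PercRepro — THE LARGE-CIRCUIT-SUMMAND CONSUMER AT `(9, 4)`: CIRCUITS OF `6` TO `10` ELEMENTS (p2, gen 28;
SUBCLAIM-S1 §6.10 (xvii)(f))

**C-025 at `(9, 4)` holds on `M ⊕ N` whenever `N` is a circuit of `s + 1 ≥ 6` elements and `M` has rank
`9 − s`** — no hypothesis on `M` beyond its rank, and no tree cell: `#U(M ⊕ N; 9, 4) ≤ N_M(r, 4) + (s + 1) N_M(r, 3)
≤ (s + 1) f_M(r)` (the two profile sets are disjoint subsets of the rank level `r = 9 − s`), while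
`#Y(M ⊕ N; 9, 4) ≥ f_M(r) · (C(s+1, s−4) + C(s+1, s−3) + C(s+1, s−2) + C(s+1, s−1))`, and the binomial sum
exceeds `Φ(9, 4) · (s + 1) = 8.4 (s + 1)` for every `5 ≤ s ≤ 9` (`56 ≥ 50.4` at `s = 5`, `112 ≥ 58.8`, `210 ≥ 67.2`,
`372 ≥ 75.6`, `627 ≥ 84`). With `S1DisjointSumCircuitFour` / `Five` this closes the `(9, 4)` body on every
`1`-separable matroid with a circuit summand of size `≥ 4` — the wrapper `c025_nine_four_disjointSum_circuit`.
Nothing else is claimed about any cell.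

* `ncard_U_disjointSum_circuit_large_le`, `ncard_Y_disjointSum_circuit_large_ge` — the two sides;
* `binomial_sum_large` — the numeric inequality `42 (s + 1) ≤ 5 · (…)`;
* **`c025_nine_four_disjointSum_circuit_large`** — the large-circuit consumer;
* **`c025_nine_four_disjointSum_circuit`** — every circuit summand of size `≥ 4`.
Axioms: standard.
-/

open scoped Matroid

namespace PercRepro

namespace S1

open Set

variable {α : Type}

/-- **The `U`-side, symbolic**: `#U(M ⊕ N; 9, 4) ≤ (s + 1) · f_M(r)` for `M` of rank `r`, `N` a circuit of
`s + 1` elements, `r + s = 9`, `s ≥ 2`. -/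
theorem ncard_U_disjointSum_circuit_large_le (M N : Matroid α) [M.Finite] [N.Finite] (h : Disjoint M.E N.E)
    {r s : ℕ} (hrs : r + s = 9) (hs : 2 ≤ s) (hM : M.eRank = r) (hN : N.IsCircuit N.E)
    (hNs : N.E.ncard = s + 1) :
    {A : Set α | A ⊆ (M.disjointSum N h).E ∧ (M.disjointSum N h).eRk A = ((9 : ℕ) : ℕ∞) ∧
        (M.disjointSum N h).eRk ((M.disjointSum N h).E \ A) = ((4 : ℕ) : ℕ∞)}.ncard ≤
      (s + 1) * (rankSet M r).ncard := by
  have hNr : N.eRank = ((s : ℕ) : ℕ∞) := eRank_eq_of_isCircuit_ground hN hNs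
  rw [disjointSum_ncard_U_eq_finsum M N h 9 4, finsum_mem_coe_finset]
  rw [Finset.sum_eq_add_of_mem (r, 4) (r, 3)
    (by simp only [Finset.mem_product, Finset.mem_range]; omega)
    (by simp only [Finset.mem_product, Finset.mem_range]; omega)
    (by simp only [ne_eq, Prod.mk.injEq]; norm_num) ?_]
  · dsimp only
    rw [show 9 - r = s by omega, show (4 : ℕ) - 4 = 0 from rfl, show (4 : ℕ) - 3 = 1 from rfl]
    have h0 := ncard_profileSet_top_zero_le hN hNs (by omega)
    have h1 := ncard_profileSet_top_one_le hN hNs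
    have hdisj : Disjoint (profileSet M r 4) (profileSet M r 3) := by
      rw [Set.disjoint_left]
      rintro A ⟨-, -, h4⟩ ⟨-, -, h3⟩
      have h43 := h4.symm.trans h3
      have h43' : (4 : ℕ) = 3 := by exact_mod_cast h43
      omega
    have hsum : (profileSet M r 4).ncard + (profileSet M r 3).ncard ≤ (rankSet M r).ncard := by
      rw [← ncard_union_eq hdisj ((rankSet_finite M r).subset (profileSet_subset_rankSet M r 4))
        ((rankSet_finite M r).subset (profileSet_subset_rankSet M r 3))]
      exact ncard_le_ncard (union_subset (profileSet_subset_rankSet M r 4) (profileSet_subset_rankSet M r 3))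
        (rankSet_finite M r)
    calc (profileSet M r 4).ncard * (profileSet N s 0).ncard +
          (profileSet M r 3).ncard * (profileSet N s 1).ncard
        ≤ (profileSet M r 4).ncard * 1 + (profileSet M r 3).ncard * (s + 1) :=
          Nat.add_le_add (Nat.mul_le_mul_left _ h0) (Nat.mul_le_mul_left _ h1)
      _ ≤ (profileSet M r 4).ncard * (s + 1) + (profileSet M r 3).ncard * (s + 1) :=
          Nat.add_le_add_right (Nat.mul_le_mul_left _ (by omega)) _
      _ = (s + 1) * ((profileSet M r 4).ncard + (profileSet M r 3).ncard) := by ring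
      _ ≤ (s + 1) * (rankSet M r).ncard := Nat.mul_le_mul_left _ hsum
  · rintro ⟨a, b⟩ hmem ⟨hne1, hne2⟩
    rw [Finset.mem_product, Finset.mem_range, Finset.mem_range] at hmem
    dsimp only
    rcases Nat.lt_or_ge r a with ha | ha
    · rw [profileSet_eq_empty_of_eRank_lt M hM ha b, ncard_empty, zero_mul]
    rcases Nat.lt_or_ge a r with ha' | ha'
    · rw [profileSet_eq_empty_of_eRank_lt N hNr (by omega) (4 - b), ncard_empty, mul_zero]
    have har : a = r := by omega
    subst har
    have hb : b ≤ 2 := by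
      rcases Nat.lt_or_ge b 3 with hb | hb
      · omega
      · exfalso
        rcases Nat.lt_or_ge b 4 with hb4 | hb4
        · exact hne2 (by congr 1; omega)
        · exact hne1 (by congr 1; omega)
    rw [show 9 - a = s by omega, profileSet_top_eq_empty_of_two_le hN hNs (by omega), ncard_empty,
      mul_zero]

/-- **The `Y`-side, symbolic**: for `N` a circuit of `s + 1` elements and `r + s = 9`, `5 ≤ s`, the four
slices `(r, a₂)`, `s − 4 ≤ a₂ ≤ s − 1`, give
`#Y(M ⊕ N; 9, 4) ≥ f_M(r) · (C(s+1, s−4) + C(s+1, s−3) + C(s+1, s−2) + C(s+1, s−1))`. -/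
theorem ncard_Y_disjointSum_circuit_large_ge (M N : Matroid α) [M.Finite] [N.Finite] (h : Disjoint M.E N.E)
    {r s : ℕ} (hrs : r + s = 9) (hs : 5 ≤ s) (hN : N.IsCircuit N.E) (hNs : N.E.ncard = s + 1) :
    (rankSet M r).ncard * (Nat.choose (s + 1) (s - 4) + Nat.choose (s + 1) (s - 3) +
        Nat.choose (s + 1) (s - 2) + Nat.choose (s + 1) (s - 1)) ≤
      {A : Set α | A ⊆ (M.disjointSum N h).E ∧ ((4 : ℕ) : ℕ∞) < (M.disjointSum N h).eRk A ∧
        (M.disjointSum N h).eRk A < ((9 : ℕ) : ℕ∞)}.ncard := by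
  rw [disjointSum_ncard_Y_eq_finsum M N h 9 4, finsum_mem_coe_finset]
  have hsub : ({(r, s - 4), (r, s - 3), (r, s - 2), (r, s - 1)} : Finset (ℕ × ℕ)) ⊆
      (Finset.range 9 ×ˢ Finset.range 9).filter (fun x : ℕ × ℕ => 4 < x.1 + x.2 ∧ x.1 + x.2 < 9) := by
    intro x hx
    simp only [Finset.mem_insert, Finset.mem_singleton] at hx
    simp only [Finset.mem_filter, Finset.mem_product, Finset.mem_range]
    rcases hx with rfl | rfl | rfl | rfl <;> (dsimp only; omega)
  refine le_trans ?_ (Finset.sum_le_sum_of_subset hsub)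
  rw [Finset.sum_insert (by simp only [Finset.mem_insert, Finset.mem_singleton, Prod.mk.injEq]; omega),
    Finset.sum_insert (by simp only [Finset.mem_insert, Finset.mem_singleton, Prod.mk.injEq]; omega),
    Finset.sum_insert (by simp only [Finset.mem_singleton, Prod.mk.injEq]; omega), Finset.sum_singleton]
  dsimp only
  have f4 := choose_le_ncard_rankSet_of_isCircuit_ground hN hNs (a := s - 4) (by omega)
  have f3 := choose_le_ncard_rankSet_of_isCircuit_ground hN hNs (a := s - 3) (by omega)
  have f2 := choose_le_ncard_rankSet_of_isCircuit_ground hN hNs (a := s - 2) (by omega)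
  have f1 := choose_le_ncard_rankSet_of_isCircuit_ground hN hNs (a := s - 1) (by omega)
  have e4 := Nat.mul_le_mul_left (rankSet M r).ncard f4
  have e3 := Nat.mul_le_mul_left (rankSet M r).ncard f3
  have e2 := Nat.mul_le_mul_left (rankSet M r).ncard f2
  have e1 := Nat.mul_le_mul_left (rankSet M r).ncard f1
  linarith

/-- The numeric inequality of the large-circuit consumer: `42 (s + 1) ≤ 5 · (C(s+1, s−4) + C(s+1, s−3) +
C(s+1, s−2) + C(s+1, s−1))` for `5 ≤ s ≤ 9`. -/
theorem binomial_sum_large {s : ℕ} (hs : 5 ≤ s) (hs9 : s ≤ 9) :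
    42 * (s + 1) ≤ 5 * (Nat.choose (s + 1) (s - 4) + Nat.choose (s + 1) (s - 3) +
      Nat.choose (s + 1) (s - 2) + Nat.choose (s + 1) (s - 1)) := by
  interval_cases s <;> decide

/-- The arithmetic of the large-circuit consumer, abstracted: `42 u ≤ 5 y` gives `(42/5) u ≤ y`. -/
theorem consumer_arith_circuit_large {u y : ℚ} (h : 42 * u ≤ 5 * y) : 42 / 5 * u ≤ y := by
  linarith

/-- **THE LARGE-CIRCUIT-SUMMAND CONSUMER**: `Φ(9, 4) · #U(M ⊕ N; 9, 4) ≤ #Y(M ⊕ N; 9, 4)` for every finite `M`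
of rank `r` and every finite `N` whose ground set is a circuit of `s + 1 ≥ 6` elements, `r + s = 9`. -/
theorem c025_nine_four_disjointSum_circuit_large (M N : Matroid α) [M.Finite] [N.Finite]
    (h : Disjoint M.E N.E) {r s : ℕ} (hrs : r + s = 9) (hs : 5 ≤ s) (hM : M.eRank = r)
    (hN : N.IsCircuit N.E) (hNs : N.E.ncard = s + 1) :
    phiK 9 4 * ({A : Set α | A ⊆ (M.disjointSum N h).E ∧ (M.disjointSum N h).eRk A = ((9 : ℕ) : ℕ∞) ∧
        (M.disjointSum N h).eRk ((M.disjointSum N h).E \ A) = ((4 : ℕ) : ℕ∞)}.ncard : ℚ) ≤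
      ({A : Set α | A ⊆ (M.disjointSum N h).E ∧ ((4 : ℕ) : ℕ∞) < (M.disjointSum N h).eRk A ∧
        (M.disjointSum N h).eRk A < ((9 : ℕ) : ℕ∞)}.ncard : ℚ) := by
  have hU := ncard_U_disjointSum_circuit_large_le M N h hrs (by omega) hM hN hNs
  have hY := ncard_Y_disjointSum_circuit_large_ge M N h hrs hs hN hNs
  have hb := binomial_sum_large hs (by omega)
  have hkey : 42 * {A : Set α | A ⊆ (M.disjointSum N h).E ∧ (M.disjointSum N h).eRk A = ((9 : ℕ) : ℕ∞) ∧
        (M.disjointSum N h).eRk ((M.disjointSum N h).E \ A) = ((4 : ℕ) : ℕ∞)}.ncard ≤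
      5 * {A : Set α | A ⊆ (M.disjointSum N h).E ∧ ((4 : ℕ) : ℕ∞) < (M.disjointSum N h).eRk A ∧
        (M.disjointSum N h).eRk A < ((9 : ℕ) : ℕ∞)}.ncard := by
    calc 42 * {A : Set α | A ⊆ (M.disjointSum N h).E ∧ (M.disjointSum N h).eRk A = ((9 : ℕ) : ℕ∞) ∧
          (M.disjointSum N h).eRk ((M.disjointSum N h).E \ A) = ((4 : ℕ) : ℕ∞)}.ncard
        ≤ 42 * ((s + 1) * (rankSet M r).ncard) := Nat.mul_le_mul_left _ hU
      _ = (42 * (s + 1)) * (rankSet M r).ncard := by ring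
      _ ≤ (5 * (Nat.choose (s + 1) (s - 4) + Nat.choose (s + 1) (s - 3) +
            Nat.choose (s + 1) (s - 2) + Nat.choose (s + 1) (s - 1))) * (rankSet M r).ncard :=
          Nat.mul_le_mul_right _ hb
      _ = 5 * ((rankSet M r).ncard * (Nat.choose (s + 1) (s - 4) + Nat.choose (s + 1) (s - 3) +
            Nat.choose (s + 1) (s - 2) + Nat.choose (s + 1) (s - 1))) := by ring
      _ ≤ 5 * {A : Set α | A ⊆ (M.disjointSum N h).E ∧ ((4 : ℕ) : ℕ∞) < (M.disjointSum N h).eRk A ∧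
            (M.disjointSum N h).eRk A < ((9 : ℕ) : ℕ∞)}.ncard := Nat.mul_le_mul_left _ hY
  rw [phiK_nine_four]
  have hkey' : (42 : ℚ) * (({A : Set α | A ⊆ (M.disjointSum N h).E ∧
      (M.disjointSum N h).eRk A = ((9 : ℕ) : ℕ∞) ∧
      (M.disjointSum N h).eRk ((M.disjointSum N h).E \ A) = ((4 : ℕ) : ℕ∞)}.ncard : ℕ) : ℚ) ≤
      5 * (({A : Set α | A ⊆ (M.disjointSum N h).E ∧ ((4 : ℕ) : ℕ∞) < (M.disjointSum N h).eRk A ∧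
        (M.disjointSum N h).eRk A < ((9 : ℕ) : ℕ∞)}.ncard : ℕ) : ℚ) := by
    exact_mod_cast hkey
  exact consumer_arith_circuit_large hkey'

/-- **EVERY CIRCUIT SUMMAND OF SIZE `≥ 4`**: `Φ(9, 4) · #U(M ⊕ N; 9, 4) ≤ #Y(M ⊕ N; 9, 4)` for every finite
coloop-free `M` of rank `r` and every finite `N` whose ground set is a circuit of `s + 1 ≥ 4` elements with
`r + s = 9` — the three consumers `S1DisjointSumCircuitFour` (`s = 3`), `S1DisjointSumCircuitFive` (`s = 4`)
and `c025_nine_four_disjointSum_circuit_large` (`s ≥ 5`) assembled. -/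
theorem c025_nine_four_disjointSum_circuit (M N : Matroid α) [M.Finite] [N.Finite]
    (h : Disjoint M.E N.E) {r s : ℕ} (hrs : r + s = 9) (hs : 3 ≤ s) (hM : M.eRank = r)
    (hcol : M.coloops = ∅) (hN : N.IsCircuit N.E) (hNs : N.E.ncard = s + 1) :
    phiK 9 4 * ({A : Set α | A ⊆ (M.disjointSum N h).E ∧ (M.disjointSum N h).eRk A = ((9 : ℕ) : ℕ∞) ∧
        (M.disjointSum N h).eRk ((M.disjointSum N h).E \ A) = ((4 : ℕ) : ℕ∞)}.ncard : ℚ) ≤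
      ({A : Set α | A ⊆ (M.disjointSum N h).E ∧ ((4 : ℕ) : ℕ∞) < (M.disjointSum N h).eRk A ∧
        (M.disjointSum N h).eRk A < ((9 : ℕ) : ℕ∞)}.ncard : ℚ) := by
  rcases Nat.lt_or_ge s 5 with hs5 | hs5
  · rcases Nat.lt_or_ge s 4 with hs4 | hs4
    · have hs3 : s = 3 := by omega
      subst hs3
      have hr : r = 6 := by omega
      subst hr
      exact c025_nine_four_disjointSum_circuit_four M N h hM hcol hN hNs
    · have hs4' : s = 4 := by omega
      subst hs4'
      have hr : r = 5 := by omega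
      subst hr
      exact c025_nine_four_disjointSum_circuit_five M N h hM hcol hN hNs
  · exact c025_nine_four_disjointSum_circuit_large M N h hrs hs5 hM hN hNs

end S1

end PercRepro
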